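import Summits.ResolutionOfSingularities.ResolutionOfSingularities.Theorems.FrobeniusLadderFInjectiveMacaulayficationQ6PrimeTower
import Mathlib.RingTheory.MvPolynomial.Basic
import Mathlib.RingTheory.Polynomial.GaussLemma
import Mathlib.RingTheory.Polynomial.RationalRoot
import Mathlib.RingTheory.Polynomial.UniqueFactorization
import Mathlib.Algebra.MvPolynomial.Equiv
import Mathlib.RingTheory.Localization.Away.Basic
import Mathlib.RingTheory.Localization.Integral
import HarnessLib

/-!
# The `w`-chart carrier of the P-cone: `k[Y,x,y,w]/(Y² + w⁵ + (x²+y³)³)` is a domain (crux `FInjectiveMacaulayfication`, line H4-gd, calibration G6ᵍ-P)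

Support file for crux stmt-ResolutionOfSingularities-15315 (`FrobeniusLadder.FInjectiveMacaulayfication`), line (H4-gd), calibration
G6ᵍ-P (CRUX-PLAN w45a v9 R9.3; seat res-L1-w45a-stub-2): the PRIMALITY input of `GradedDomainConeFiModel.stub_gradedDomainConeFiModel`
(p500711) for idea-2's codimension-2 specimen `P = V(x²+y³−wU, Z²+wU³+w³) ⊂ 𝔸⁵` is proved (next file, `…PConePrime`) by embedding
`k[x,y,w,Z,U]/(F₁,F₂)` into the localisation `A[1/w̄]` of the hypersurface ring `A = k[Y,x,y,w]/(G)`, `G = Y² + w⁵ + (x²+y³)³`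
(`Y = Zw`, `U = (x²+y³)/w`). THIS FILE: `G` is prime (Gauss over the UFD `k[x,y,w]`: the monic quadratic `Y² + (w⁵+(x²+y³)³)` has no root
in `k(x,y,w)` because a root would lie in `k[x,y,w]` (integrally closed) and specialise under `x,y ↦ 0, w ↦ X` to `q(X)² = −X⁵`, impossible by
degree parity — EVERY characteristic, including `2`), the variables and `x²+y³` are non-zero in `A`, and `A`, `A[1/w̄]` are domains.
Variables of `k[Y,x,y,w] = MvPolynomial (Fin 4) k`: `(Y,x,y,w) = (X 0, X 1, X 2, X 3)`. Pattern: `Q6Prime` (res-L1-w45a-stub-3).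
[OURS · L1 W4.5a] AI-written; AI review is weaker than expert review. No statement of Hironaka2017 is used; no external fact.
No definitions, no named facts. [folklore]
-/

set_option linter.dupNamespace false

noncomputable section

open Polynomial

namespace Summit.ResolutionOfSingularities.ResolutionOfSingularities.Theorems.FInjectiveMacaulayfication.PConePrimeCarrier

open Summit.ResolutionOfSingularities.ResolutionOfSingularities.Theorems.FInjectiveMacaulayfication

variable {k : Type} [Field k]

/-! ## `−(w⁵ + (x²+y³)³)` is not a square -/

/-- In `k[X]`, `q² ≠ −X⁵` (degree parity; any characteristic). [folklore] -/
theorem not_sq_specialised (q : k[X]) : q ^ 2 ≠ -X ^ 5 := by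
  intro h
  have hdeg := congrArg Polynomial.natDegree h
  rw [Polynomial.natDegree_pow, Polynomial.natDegree_neg, Polynomial.natDegree_X_pow] at hdeg
  omega

/-- The specialisation `x, y ↦ 0`, `w ↦ X` sends `w⁵ + (x²+y³)³` to `X⁵`. [folklore] -/
theorem specialise_c :
    MvPolynomial.aeval (R := k) (![0, 0, Polynomial.X] : Fin 3 → k[X])
      (MvPolynomial.X 2 ^ 5 + (MvPolynomial.X 0 ^ 2 + MvPolynomial.X 1 ^ 3) ^ 3) = X ^ 5 := by
  simp only [map_add, map_pow, MvPolynomial.aeval_X, Matrix.cons_val_zero, Matrix.cons_val_one, Matrix.cons_val]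
  ring

/-- **`−(w⁵ + (x²+y³)³)` is not a square in `k(x,y,w)`**: a square root is integral over the integrally closed `k[x,y,w]`,
hence polynomial, and specialises to a square root of `−X⁵` in `k[X]`. [folklore] -/
theorem not_sq (d : FractionRing (MvPolynomial (Fin 3) k)) :
    d ^ 2 ≠ algebraMap (MvPolynomial (Fin 3) k) (FractionRing (MvPolynomial (Fin 3) k))
      (-(MvPolynomial.X 2 ^ 5 + (MvPolynomial.X 0 ^ 2 + MvPolynomial.X 1 ^ 3) ^ 3)) := by
  haveI : IsIntegrallyClosed (MvPolynomial (Fin 3) k) := UniqueFactorizationMonoid.instIsIntegrallyClosed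
  intro hd
  have hint : IsIntegral (MvPolynomial (Fin 3) k) d := by
    refine ⟨Polynomial.X ^ 2 - Polynomial.C (-(MvPolynomial.X 2 ^ 5 + (MvPolynomial.X 0 ^ 2 + MvPolynomial.X 1 ^ 3) ^ 3)),
      monic_X_pow_sub_C _ two_ne_zero, ?_⟩
    rw [eval₂_sub, eval₂_X_pow, eval₂_C, hd, sub_self]
  obtain ⟨e, he⟩ := (IsIntegrallyClosed.isIntegral_iff (R := MvPolynomial (Fin 3) k)).mp hint
  rw [← he, ← map_pow] at hd
  have hd' := IsFractionRing.injective (MvPolynomial (Fin 3) k) (FractionRing (MvPolynomial (Fin 3) k)) hd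
  have h := congrArg (MvPolynomial.aeval (R := k) (![0, 0, Polynomial.X] : Fin 3 → k[X])) hd'
  rw [map_pow, map_neg, specialise_c] at h
  exact not_sq_specialised _ h

/-! ## `G = Y² + w⁵ + (x²+y³)³` is prime -/

/-- **`Y² + (w⁵ + (x²+y³)³)` is irreducible in `k[x,y,w][Y]`**: no root in `k(x,y,w)` (`not_sq`), monic, Gauss. [folklore] -/
theorem irreducible_quadratic_R :
    Irreducible (Polynomial.X ^ 2 + Polynomial.C (MvPolynomial.X 2 ^ 5 + (MvPolynomial.X 0 ^ 2 + MvPolynomial.X 1 ^ 3) ^ 3 :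
      MvPolynomial (Fin 3) k)) := by
  haveI : IsIntegrallyClosed (MvPolynomial (Fin 3) k) := UniqueFactorizationMonoid.instIsIntegrallyClosed
  have hmonic : (Polynomial.X ^ 2 + Polynomial.C (MvPolynomial.X 2 ^ 5 + (MvPolynomial.X 0 ^ 2 + MvPolynomial.X 1 ^ 3) ^ 3 :
      MvPolynomial (Fin 3) k)).Monic := monic_X_pow_add_C _ two_ne_zero
  rw [hmonic.irreducible_iff_irreducible_map_fraction_map (K := FractionRing (MvPolynomial (Fin 3) k)), Polynomial.map_add,
    Polynomial.map_pow, Polynomial.map_X, Polynomial.map_C]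
  have hF := Q6PrimeTower.irreducible_X_sq_sub_C
    (algebraMap (MvPolynomial (Fin 3) k) (FractionRing (MvPolynomial (Fin 3) k))
      (-(MvPolynomial.X 2 ^ 5 + (MvPolynomial.X 0 ^ 2 + MvPolynomial.X 1 ^ 3) ^ 3))) (fun d => not_sq d)
  rwa [map_neg, map_neg, sub_neg_eq_add] at hF

/-- The chart `k[Y,x,y,w] ≅ k[x,y,w][Y]` (`MvPolynomial.finSuccEquiv`, `Y = X 0`) carries `G` to the monic quadratic. [folklore] -/
theorem transfer_G (G : MvPolynomial (Fin 4) k)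
    (hG : G = MvPolynomial.X 0 ^ 2 + MvPolynomial.X 3 ^ 5 + (MvPolynomial.X 1 ^ 2 + MvPolynomial.X 2 ^ 3) ^ 3) :
    MvPolynomial.finSuccEquiv k 3 G =
      Polynomial.X ^ 2 + Polynomial.C (MvPolynomial.X 2 ^ 5 + (MvPolynomial.X 0 ^ 2 + MvPolynomial.X 1 ^ 3) ^ 3 :
        MvPolynomial (Fin 3) k) := by
  rw [hG]
  simp only [map_add, map_pow, MvPolynomial.finSuccEquiv_X_zero, show (3 : Fin 4) = Fin.succ 2 from rfl,
    show (1 : Fin 4) = Fin.succ 0 from rfl, show (2 : Fin 4) = Fin.succ 1 from rfl, MvPolynomial.finSuccEquiv_X_succ]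
  ring

/-- **`G = Y² + w⁵ + (x²+y³)³` is irreducible in `k[Y,x,y,w]`** (every characteristic). [folklore] -/
theorem g_irreducible (G : MvPolynomial (Fin 4) k)
    (hG : G = MvPolynomial.X 0 ^ 2 + MvPolynomial.X 3 ^ 5 + (MvPolynomial.X 1 ^ 2 + MvPolynomial.X 2 ^ 3) ^ 3) :
    Irreducible G := by
  have hirr := irreducible_quadratic_R (k := k)
  rw [← transfer_G G hG] at hirr
  exact (MulEquiv.irreducible_iff (MvPolynomial.finSuccEquiv k 3).toMulEquiv).mp hirr

/-- **`(G)` is a prime ideal of `k[Y,x,y,w]`.** [folklore] -/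
theorem g_isPrime (G : MvPolynomial (Fin 4) k)
    (hG : G = MvPolynomial.X 0 ^ 2 + MvPolynomial.X 3 ^ 5 + (MvPolynomial.X 1 ^ 2 + MvPolynomial.X 2 ^ 3) ^ 3) :
    (Ideal.span {G}).IsPrime :=
  (Ideal.span_singleton_prime (g_irreducible G hG).ne_zero).mpr (g_irreducible G hG).prime

/-! ## Non-zero elements of `A = k[Y,x,y,w]/(G)` -/

/-- `G` divides no non-zero polynomial of `Y`-degree `≤ 1` (it is monic of `Y`-degree `2`). [folklore] -/
theorem not_dvd_of_natDegree_le_one (G : MvPolynomial (Fin 4) k)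
    (hG : G = MvPolynomial.X 0 ^ 2 + MvPolynomial.X 3 ^ 5 + (MvPolynomial.X 1 ^ 2 + MvPolynomial.X 2 ^ 3) ^ 3)
    (q : MvPolynomial (Fin 4) k) (hq : (MvPolynomial.finSuccEquiv k 3 q).natDegree ≤ 1)
    (hq0 : MvPolynomial.finSuccEquiv k 3 q ≠ 0) : ¬ G ∣ q := by
  intro hdvd
  have h2 : (MvPolynomial.finSuccEquiv k 3 G).natDegree = 2 := by
    rw [transfer_G G hG, Polynomial.natDegree_X_pow_add_C]
  have hle := Polynomial.natDegree_le_of_dvd (map_dvd (MvPolynomial.finSuccEquiv k 3) hdvd) hq0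
  omega

/-- `q̄ ≠ 0` in `A = k[Y,x,y,w]/(G)` for `q` non-zero of `Y`-degree `≤ 1`. [folklore] -/
theorem mk_ne_zero (G : MvPolynomial (Fin 4) k)
    (hG : G = MvPolynomial.X 0 ^ 2 + MvPolynomial.X 3 ^ 5 + (MvPolynomial.X 1 ^ 2 + MvPolynomial.X 2 ^ 3) ^ 3)
    (q : MvPolynomial (Fin 4) k) (hq : (MvPolynomial.finSuccEquiv k 3 q).natDegree ≤ 1)
    (hq0 : MvPolynomial.finSuccEquiv k 3 q ≠ 0) : Ideal.Quotient.mk (Ideal.span {G}) q ≠ 0 := by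
  rw [Ne, Ideal.Quotient.eq_zero_iff_mem, Ideal.mem_span_singleton]
  exact not_dvd_of_natDegree_le_one G hG q hq hq0

/-- `Ȳ ≠ 0` in `A`. [folklore] -/
theorem mk_Y_ne_zero (G : MvPolynomial (Fin 4) k)
    (hG : G = MvPolynomial.X 0 ^ 2 + MvPolynomial.X 3 ^ 5 + (MvPolynomial.X 1 ^ 2 + MvPolynomial.X 2 ^ 3) ^ 3) :
    Ideal.Quotient.mk (Ideal.span {G}) (MvPolynomial.X 0) ≠ 0 := by
  refine mk_ne_zero G hG _ ?_ ?_ <;> rw [MvPolynomial.finSuccEquiv_X_zero]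
  · exact Polynomial.natDegree_X_le
  · exact Polynomial.X_ne_zero

/-- `x̄, ȳ, w̄ ≠ 0` in `A` (the variables `X 1, X 2, X 3`). [folklore] -/
theorem mk_X_succ_ne_zero (G : MvPolynomial (Fin 4) k)
    (hG : G = MvPolynomial.X 0 ^ 2 + MvPolynomial.X 3 ^ 5 + (MvPolynomial.X 1 ^ 2 + MvPolynomial.X 2 ^ 3) ^ 3) (i : Fin 3) :
    Ideal.Quotient.mk (Ideal.span {G}) (MvPolynomial.X i.succ) ≠ 0 := by
  refine mk_ne_zero G hG _ ?_ ?_ <;> rw [MvPolynomial.finSuccEquiv_X_succ]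
  · rw [Polynomial.natDegree_C]; exact zero_le_one
  · exact Polynomial.C_ne_zero.mpr (MvPolynomial.X_ne_zero i)

/-- `w̄ ≠ 0` in `A` (the variable `X 3`). [folklore] -/
theorem mk_w_ne_zero (G : MvPolynomial (Fin 4) k)
    (hG : G = MvPolynomial.X 0 ^ 2 + MvPolynomial.X 3 ^ 5 + (MvPolynomial.X 1 ^ 2 + MvPolynomial.X 2 ^ 3) ^ 3) :
    Ideal.Quotient.mk (Ideal.span {G}) (MvPolynomial.X 3) ≠ 0 :=
  mk_X_succ_ne_zero G hG 2

/-- `x̄² + ȳ³ ≠ 0` in `A`. [folklore] -/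
theorem mk_t_ne_zero (G : MvPolynomial (Fin 4) k)
    (hG : G = MvPolynomial.X 0 ^ 2 + MvPolynomial.X 3 ^ 5 + (MvPolynomial.X 1 ^ 2 + MvPolynomial.X 2 ^ 3) ^ 3) :
    Ideal.Quotient.mk (Ideal.span {G}) (MvPolynomial.X 1 ^ 2 + MvPolynomial.X 2 ^ 3) ≠ 0 := by
  have he : MvPolynomial.finSuccEquiv k 3 (MvPolynomial.X 1 ^ 2 + MvPolynomial.X 2 ^ 3) =
      Polynomial.C (MvPolynomial.X 0 ^ 2 + MvPolynomial.X 1 ^ 3) := by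
    simp only [map_add, map_pow, show (1 : Fin 4) = Fin.succ 0 from rfl, show (2 : Fin 4) = Fin.succ 1 from rfl,
      MvPolynomial.finSuccEquiv_X_succ]
  refine mk_ne_zero G hG _ ?_ ?_ <;> rw [he]
  · rw [Polynomial.natDegree_C]; exact zero_le_one
  · rw [Ne, Polynomial.C_eq_zero]
    intro h
    have h' := congrArg (MvPolynomial.coeff (Finsupp.single 0 2)) h
    rw [MvPolynomial.coeff_add, MvPolynomial.X_pow_eq_monomial, MvPolynomial.X_pow_eq_monomial, MvPolynomial.coeff_monomial,
      MvPolynomial.coeff_monomial, if_pos rfl, if_neg, MvPolynomial.coeff_zero] at h'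
    · norm_num at h'
    · intro hh
      have := congrArg (fun f => f 0) hh
      simp at this

/-! ## The domains `A` and `A[1/w̄]` -/

/-- `A = k[Y,x,y,w]/(G)` is a domain. [folklore] -/
theorem isDomain_A (G : MvPolynomial (Fin 4) k)
    (hG : G = MvPolynomial.X 0 ^ 2 + MvPolynomial.X 3 ^ 5 + (MvPolynomial.X 1 ^ 2 + MvPolynomial.X 2 ^ 3) ^ 3) :
    IsDomain (MvPolynomial (Fin 4) k ⧸ Ideal.span {G}) :=
  haveI := g_isPrime G hG
  Ideal.Quotient.isDomain _

/-- `A[1/w̄]` is a domain (`w̄ ≠ 0` in the domain `A`). [folklore] -/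
theorem isDomain_away (G : MvPolynomial (Fin 4) k)
    (hG : G = MvPolynomial.X 0 ^ 2 + MvPolynomial.X 3 ^ 5 + (MvPolynomial.X 1 ^ 2 + MvPolynomial.X 2 ^ 3) ^ 3) :
    IsDomain (Localization.Away (Ideal.Quotient.mk (Ideal.span {G}) (MvPolynomial.X 3))) := by
  haveI := isDomain_A G hG
  exact IsLocalization.isDomain_localization
    (powers_le_nonZeroDivisors_of_noZeroDivisors (mk_w_ne_zero G hG))

/-- `A → A[1/w̄]` is injective. [folklore] -/
theorem algebraMap_away_injective (G : MvPolynomial (Fin 4) k)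
    (hG : G = MvPolynomial.X 0 ^ 2 + MvPolynomial.X 3 ^ 5 + (MvPolynomial.X 1 ^ 2 + MvPolynomial.X 2 ^ 3) ^ 3) :
    Function.Injective (algebraMap (MvPolynomial (Fin 4) k ⧸ Ideal.span {G})
      (Localization.Away (Ideal.Quotient.mk (Ideal.span {G}) (MvPolynomial.X 3)))) := by
  haveI := isDomain_A G hG
  exact IsLocalization.injective (Localization.Away (Ideal.Quotient.mk (Ideal.span {G}) (MvPolynomial.X 3)))
    (powers_le_nonZeroDivisors_of_noZeroDivisors (mk_w_ne_zero G hG))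

end Summit.ResolutionOfSingularities.ResolutionOfSingularities.Theorems.FInjectiveMacaulayfication.PConePrimeCarrier

end
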